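import Summits.PneNP.PneNP.Theorems.MonotoneBlind.Negative.DegreeTestCounting
import Summits.PneNP.PneNP.Theorems.KarlinRubinMonotoneBlindDelta

/-!
# `MonotoneBlind` (stmt-PneNP-18027, route PneNP/KarlinRubin, crux #3) — negative-side lemmas III(b):
# Kučera's degree test detects at every `δ < 0` — the crux's hypothesis `0 < δ` is sharp

Crux-disprover output (cdisprove cycle 1), second half (probability forms and asymptotics) of the
construction of `DegreeTestCounting.lean`; closes the near-miss `monotoneBlindAt_false_of_neg` recorded
in `Cruxes/MonotoneBlind/Disproof.lean` §B.

* `degTest_typeI_le`, `degTest_typeII_le` — the counting bounds as `G(n,1/2)` / `G(n,1/2,k)`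
  probabilities (`erdosRenyiHalf_le_ofReal`, fibre formula `plantedCliqueDist_toOuterMeasure_eq_sum`).
* `degTest_errSum_le` — with zero-budget `j₀ = ⌊(2n-k)/4⌋` (threshold `deg ≳ n/2 + k/4`) and
  `16 ≤ k ≤ n/2`: error sum `≤ (n+1) · exp(-k²/(32 n))`.
* `degTest_detects` — for a clique-size sequence with `16 ≤ k n ≤ n/2` eventually and
  `(n+1) exp(-(k n)²/(32 n)) → 0`, the max-degree family is monotone at every `n`, has `≤ n⁴` gates
  eventually, and error sum `→ 0`.
* `exists_monotone_poly_strongDetector_of_neg`, `monotoneBlindAt_false_of_neg`,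
  `monotoneBlind_false_on_any_larger_range` — for EVERY `δ < 0` a monotone family of size `≤ n⁴`
  strongly detects the planted `⌈n^{1/2-δ}⌉`-clique (`k²/n ≥ n^{-2δ} → ∞`; for `δ < -1/4` by
  monotonicity in `δ`, `karlinRubin_detects_of_le`). So the hypothesis `0 < δ` of the crux is SHARP
  up to the single boundary point `δ = 0` (`k = ⌈√n⌉`), where strong MONOTONE detection in
  polynomial size is open (counts of high-degree vertices give constant error only; the spectral
  test of Alon–Krivelevich–Sudakov is not monotone). Together with `DeltaRange.lean`
  (`δ < 1/2` decorative, basis load-bearing) and `LoadBearing.lean` (size bound, error clause) this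
  completes the load-bearing table of the crux.

[Kucera1995 §1] Refuter seat refuter-cdisprove-stmt-PneNP-18027-0 (cdisprove, gen 1), 2026-08-17.
-/

set_option linter.dupNamespace false

namespace Summit.PneNP.PneNP.Theorems.MonotoneBlind.Negative

open Literature.Computability.Complexity Literature.Probability.RandomGraphs.PlantedClique Filter Finset
open Summit.PneNP.PneNP.Theorems.MonotoneContinuation.Negative (star card_star)
open scoped ENNReal

/-! ## §5 Detection above `√n` -/

/-- **Type I in probability**: `Pr_{G(n,1/2)}[max-degree test fires] ≤ n · exp(-2t²/(n-1))`. [folklore] -/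
theorem degTest_typeI_le (n j₀ : ℕ) (hn : 2 ≤ n) {t : ℝ} (ht : 0 ≤ t)
    (hj : t ≤ ((n - 1 : ℕ) : ℝ) / 2 - j₀) :
    (erdosRenyiHalf n).toOuterMeasure {x | decide (∃ v : Fin n, #((star v).filter fun e => x e = false) ≤ j₀) = true} ≤
      ENNReal.ofReal (n * Real.exp (-(2 * t ^ 2 / (n - 1 : ℕ)))) := by
  classical
  refine erdosRenyiHalf_le_ofReal _ (by positivity) ?_
  refine le_trans (le_of_eq ?_) ((degTest_typeI_count n j₀ hn ht hj).trans_eq (by ring))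
  congr 2

/-- **Type II in probability**: `Pr_{G(n,1/2,k)}[max-degree test silent] ≤ exp(-2t²/(n-k'))`,
`k' = min k n`, for `1 ≤ k' < n` and `0 ≤ t ≤ j₀ + 1 - (n-k')/2`. [folklore] -/
theorem degTest_typeII_le (n j₀ k : ℕ) (hk1 : 1 ≤ min k n) (hkn : min k n < n) {t : ℝ} (ht : 0 ≤ t)
    (hj : t ≤ (j₀ : ℝ) + 1 - ((n - min k n : ℕ) : ℝ) / 2) :
    (plantedCliqueDist n k).toOuterMeasure {x | decide (∃ v : Fin n, #((star v).filter fun e => x e = false) ≤ j₀) = false} ≤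
      ENNReal.ofReal (Real.exp (-(2 * t ^ 2 / (n - min k n : ℕ)))) := by
  classical
  rw [Summit.PneNP.PneNP.Theorems.plantedCliqueDist_toOuterMeasure_eq_sum]
  have hA : ∀ A ∈ kSubsets n k,
      (erdosRenyiHalf n).toOuterMeasure {x | plant A x ∈ {x | decide (∃ v : Fin n, #((star v).filter fun e => x e = false) ≤ j₀) = false}} ≤
        ENNReal.ofReal (Real.exp (-(2 * t ^ 2 / (n - min k n : ℕ)))) := by
    intro A hA
    have hcard : #A = min k n := card_of_mem_kSubsets hA
    obtain ⟨v₀, hv₀⟩ : A.Nonempty := card_pos.1 (by omega)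
    refine erdosRenyiHalf_le_ofReal _ (by positivity) ?_
    have hAn : #A < n := by omega
    have hj' : t ≤ (j₀ : ℝ) + 1 - ((n - #A : ℕ) : ℝ) / 2 := by rwa [hcard]
    refine le_trans (le_of_eq ?_) ((degTest_typeII_count n j₀ hv₀ hAn ht hj').trans_eq (by rw [hcard]))
    congr 2
  calc ((#(kSubsets n k) : ℕ) : ℝ≥0∞)⁻¹ *
        ∑ A ∈ kSubsets n k,
          (erdosRenyiHalf n).toOuterMeasure {x | plant A x ∈ {x | decide (∃ v : Fin n, #((star v).filter fun e => x e = false) ≤ j₀) = false}}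
      ≤ ((#(kSubsets n k) : ℕ) : ℝ≥0∞)⁻¹ *
        ∑ _A ∈ kSubsets n k, ENNReal.ofReal (Real.exp (-(2 * t ^ 2 / (n - min k n : ℕ)))) :=
        mul_le_mul_right (sum_le_sum hA) _
    _ = ENNReal.ofReal (Real.exp (-(2 * t ^ 2 / (n - min k n : ℕ)))) := by
        rw [sum_const, nsmul_eq_mul, ← mul_assoc,
          ENNReal.inv_mul_cancel (Summit.PneNP.PneNP.Theorems.card_kSubsets_cast_ne_zero n k)
            (ENNReal.natCast_ne_top _), one_mul]

/-- **Error sum of the max-degree test** with zero-budget `j₀ = ⌊(2n-k)/4⌋` (threshold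
`deg ≥ n/2 + k/4 + O(1)`), for `16 ≤ k ≤ n/2`: at most `(n+1) · exp(-k²/(32 n))`. [Kucera1995 §1] -/
theorem degTest_errSum_le (n k : ℕ) (h16 : 16 ≤ k) (h2k : 2 * k ≤ n) :
    (erdosRenyiHalf n).toOuterMeasure {x | decide (∃ v : Fin n, #((star v).filter fun e => x e = false) ≤ (2 * n - k) / 4) = true} +
      (plantedCliqueDist n k).toOuterMeasure {x | decide (∃ v : Fin n, #((star v).filter fun e => x e = false) ≤ (2 * n - k) / 4) = false} ≤
      ENNReal.ofReal (((n : ℝ) + 1) * Real.exp (-((k : ℝ) ^ 2 / (32 * n)))) := by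
  set j₀ : ℕ := (2 * n - k) / 4 with hj₀
  have hn : 2 ≤ n := by omega
  have hkn : k < n := by omega
  have hmin : min k n = k := min_eq_left hkn.le
  have hnpos : (0 : ℝ) < n := by exact_mod_cast (by omega : 0 < n)
  have hkpos : (0 : ℝ) < k := by exact_mod_cast (by omega : 0 < k)
  -- real bounds on `j₀`: `(2n-k-3)/4 ≤ j₀ ≤ (2n-k)/4`
  have hdm : 4 * j₀ + (2 * n - k) % 4 = 2 * n - k := Nat.div_add_mod _ _
  have hmod : (2 * n - k) % 4 ≤ 3 := Nat.lt_succ_iff.1 (Nat.mod_lt _ (by norm_num))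
  have hcast : (4 : ℝ) * j₀ + (((2 * n - k) % 4 : ℕ) : ℝ) = 2 * n - k := by
    have : ((4 * j₀ + (2 * n - k) % 4 : ℕ) : ℝ) = ((2 * n - k : ℕ) : ℝ) := by rw [hdm]
    push_cast [Nat.cast_sub (by omega : k ≤ 2 * n)] at this
    linarith
  have hmodR : (0 : ℝ) ≤ (((2 * n - k) % 4 : ℕ) : ℝ) ∧ (((2 * n - k) % 4 : ℕ) : ℝ) ≤ 3 :=
    ⟨Nat.cast_nonneg _, by exact_mod_cast hmod⟩
  have hj_up : (j₀ : ℝ) ≤ (2 * n - k : ℝ) / 4 := by linarith [hmodR.1]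
  have hj_lo : ((2 * n - k : ℝ) - 3) / 4 ≤ j₀ := by linarith [hmodR.2]
  have ht : (0 : ℝ) ≤ k / 8 := by positivity
  have h16R : (16 : ℝ) ≤ k := by exact_mod_cast h16
  -- type I with `t = k/8`
  have hn1 : ((n - 1 : ℕ) : ℝ) = n - 1 := by push_cast [Nat.cast_sub (by omega : 1 ≤ n)]; ring
  have hI := degTest_typeI_le n j₀ hn ht (by rw [hn1]; linarith)
  -- type II with `t = k/8`
  have hnk : ((n - min k n : ℕ) : ℝ) = n - k := by
    rw [hmin]; push_cast [Nat.cast_sub hkn.le]; ring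
  have hII := degTest_typeII_le n j₀ k (by rw [hmin]; omega) (by rw [hmin]; exact hkn) ht
    (by rw [hnk]; linarith)
  -- compare exponents with `k²/(32 n)`
  have hE : Real.exp (-((k : ℝ) ^ 2 / (32 * n))) = Real.exp (-(2 * ((k : ℝ) / 8) ^ 2 / n)) := by
    congr 1; field_simp; ring
  have hI' : Real.exp (-(2 * ((k : ℝ) / 8) ^ 2 / (n - 1 : ℕ))) ≤ Real.exp (-((k : ℝ) ^ 2 / (32 * n))) := by
    rw [hE, hn1]
    refine Real.exp_le_exp.2 (neg_le_neg ?_)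
    exact div_le_div_of_nonneg_left (by positivity) (by linarith [show (2:ℝ) ≤ n from by exact_mod_cast hn])
      (by linarith)
  have hII' : Real.exp (-(2 * ((k : ℝ) / 8) ^ 2 / (n - min k n : ℕ))) ≤ Real.exp (-((k : ℝ) ^ 2 / (32 * n))) := by
    rw [hE, hnk]
    refine Real.exp_le_exp.2 (neg_le_neg ?_)
    exact div_le_div_of_nonneg_left (by positivity)
      (by linarith [show (k:ℝ) + 1 ≤ n from by exact_mod_cast hkn]) (by linarith)
  calc (erdosRenyiHalf n).toOuterMeasure {x | decide (∃ v : Fin n, #((star v).filter fun e => x e = false) ≤ j₀) = true} +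
        (plantedCliqueDist n k).toOuterMeasure {x | decide (∃ v : Fin n, #((star v).filter fun e => x e = false) ≤ j₀) = false}
      ≤ ENNReal.ofReal (n * Real.exp (-((k : ℝ) ^ 2 / (32 * n)))) +
          ENNReal.ofReal (Real.exp (-((k : ℝ) ^ 2 / (32 * n)))) := by
        refine add_le_add (hI.trans (ENNReal.ofReal_le_ofReal ?_)) (hII.trans (ENNReal.ofReal_le_ofReal hII'))
        exact mul_le_mul_of_nonneg_left hI' hnpos.le
    _ = ENNReal.ofReal (((n : ℝ) + 1) * Real.exp (-((k : ℝ) ^ 2 / (32 * n)))) := by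
        rw [← ENNReal.ofReal_add (by positivity) (by positivity)]
        congr 1; ring

/-- **The max-degree family strongly detects whenever `k²/n → ∞` fast enough.** For a clique-size
sequence `k` with `16 ≤ k n ≤ n/2` eventually and `(n+1)·exp(-(k n)²/(32n)) → 0`, the family of
max-degree tests is monotone over `{∧₂, ∨₂, 0, 1}` at EVERY `n`, has `≤ n⁴` gates eventually, and its
error sum against the planted `k n`-clique tends to `0`. [Kucera1995 §1] -/
theorem degTest_detects {k : ℕ → ℕ} (hk : ∀ᶠ n : ℕ in atTop, 16 ≤ k n ∧ 2 * k n ≤ n)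
    (hlim : Tendsto (fun n : ℕ => ((n : ℝ) + 1) * Real.exp (-((k n : ℝ) ^ 2 / (32 * n))))
      atTop (nhds 0)) :
    ∃ C : (n : ℕ) → Circuit ((⊤ : SimpleGraph (Fin n)).edgeSet),
      (∀ n, (C n).IsOver monotoneBasis01) ∧ (∀ᶠ n : ℕ in atTop, (C n).size ≤ n ^ 4) ∧
      Tendsto (fun n : ℕ => (erdosRenyiHalf n).toOuterMeasure {x | (C n).eval x = true} +
        (plantedCliqueDist n (k n)).toOuterMeasure {x | (C n).eval x = false}) atTop (nhds 0) := by
  classical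
  let C : (n : ℕ) → Circuit ((⊤ : SimpleGraph (Fin n)).edgeSet) := fun n =>
    (exists_circuit_degTest n ((2 * n - k n) / 4)).choose
  have hC : ∀ n, (C n).IsOver monotoneBasis01 ∧
      (C n).size ≤ n * (1 + (n - 1) * (1 + 2 * ((2 * n - k n) / 4) + 3)) + (n + 1) ∧
      (C n).Computes (fun x => decide (∃ v : Fin n, #((star v).filter fun e => x e = false) ≤ (2 * n - k n) / 4)) := fun n =>
    (exists_circuit_degTest n ((2 * n - k n) / 4)).choose_spec
  refine ⟨C, fun n => (hC n).1, ?_, ?_⟩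
  · filter_upwards [eventually_ge_atTop 3] with n hn
    refine (hC n).2.1.trans ?_
    have hj : 1 + 2 * ((2 * n - k n) / 4) + 3 ≤ 2 * n + 4 := by omega
    calc n * (1 + (n - 1) * (1 + 2 * ((2 * n - k n) / 4) + 3)) + (n + 1)
        ≤ n * (1 + (n - 1) * (2 * n + 4)) + (n + 1) :=
          Nat.add_le_add_right (Nat.mul_le_mul_left _ (Nat.add_le_add_left (Nat.mul_le_mul_left _ hj) _)) _
      _ ≤ n ^ 4 := by
          obtain ⟨m, rfl⟩ : ∃ m, n = m + 3 := ⟨n - 3, by omega⟩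
          have : (m + 3 - 1) = m + 2 := by omega
          rw [this]
          nlinarith [sq_nonneg m, Nat.zero_le m]
  · have hev : ∀ᶠ n : ℕ in atTop, (erdosRenyiHalf n).toOuterMeasure {x | (C n).eval x = true} +
        (plantedCliqueDist n (k n)).toOuterMeasure {x | (C n).eval x = false} ≤
        ENNReal.ofReal (((n : ℝ) + 1) * Real.exp (-((k n : ℝ) ^ 2 / (32 * n)))) := by
      filter_upwards [hk] with n hn
      have heq : ∀ x, (C n).eval x = decide (∃ v : Fin n, #((star v).filter fun e => x e = false) ≤ (2 * n - k n) / 4) := (hC n).2.2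
      simp only [heq]
      exact degTest_errSum_le n (k n) hn.1 hn.2
    have h0 : Tendsto (fun n : ℕ =>
        ENNReal.ofReal (((n : ℝ) + 1) * Real.exp (-((k n : ℝ) ^ 2 / (32 * n))))) atTop (nhds 0) := by
      rw [← ENNReal.ofReal_zero]
      exact ENNReal.tendsto_ofReal hlim
    exact tendsto_of_tendsto_of_tendsto_of_le_of_le' tendsto_const_nhds h0
      (Eventually.of_forall fun _ => bot_le) hev

/-- **A monotone polynomial-size strong detector at every `δ ∈ [-1/4, 0)`** (clique size
`⌈n^{1/2-δ}⌉ = ⌈n^{1/2+|δ|}⌉`): the max-degree family, size `≤ n⁴`. [Kucera1995 §1] -/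
theorem exists_monotone_poly_strongDetector_of_neg {δ : ℝ} (hδ4 : -1 / 4 ≤ δ) (hδ0 : δ < 0) :
    ∃ C : (n : ℕ) → Circuit ((⊤ : SimpleGraph (Fin n)).edgeSet),
      (∀ᶠ n : ℕ in atTop, (C n).IsOver monotoneBasis01 ∧ (C n).size ≤ n ^ 4) ∧
      Tendsto (fun n : ℕ => (erdosRenyiHalf n).toOuterMeasure {x | (C n).eval x = true} +
        (plantedCliqueDist n ⌈(n : ℝ) ^ (1 / 2 - δ)⌉₊).toOuterMeasure {x | (C n).eval x = false})
        atTop (nhds 0) := by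
  set e : ℝ := 1 / 2 - δ with he
  have he1 : 1 / 2 < e := by linarith
  have he2 : e ≤ 3 / 4 := by linarith
  -- eventually `16 ≤ k n` and `2 k n ≤ n`
  have hk : ∀ᶠ n : ℕ in atTop, 16 ≤ ⌈(n : ℝ) ^ e⌉₊ ∧ 2 * ⌈(n : ℝ) ^ e⌉₊ ≤ n := by
    have h1 : Tendsto (fun n : ℕ => (n : ℝ) ^ e) atTop atTop :=
      (tendsto_rpow_atTop (by linarith)).comp tendsto_natCast_atTop_atTop
    have h2 : Tendsto (fun n : ℕ => (n : ℝ) ^ (1 - e)) atTop atTop :=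
      (tendsto_rpow_atTop (by linarith)).comp tendsto_natCast_atTop_atTop
    filter_upwards [h1.eventually_ge_atTop 16, h2.eventually_ge_atTop 4, eventually_ge_atTop 4]
      with n hn1 hn2 hn4
    have hnpos : (0 : ℝ) < n := by exact_mod_cast (by omega : 0 < n)
    constructor
    · have : (16 : ℝ) ≤ ⌈(n : ℝ) ^ e⌉₊ := le_trans hn1 (Nat.le_ceil _)
      exact_mod_cast this
    · have hne : (n : ℝ) ^ (1 - e) * (n : ℝ) ^ e = n := by
        rw [← Real.rpow_add hnpos]; norm_num
      have hle : 4 * (n : ℝ) ^ e ≤ n := by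
        calc 4 * (n : ℝ) ^ e ≤ (n : ℝ) ^ (1 - e) * (n : ℝ) ^ e :=
              mul_le_mul_of_nonneg_right hn2 (by positivity)
          _ = n := hne
      have hceil : (⌈(n : ℝ) ^ e⌉₊ : ℝ) < (n : ℝ) ^ e + 1 := Nat.ceil_lt_add_one (by positivity)
      have h4 : (4 : ℝ) ≤ n := by exact_mod_cast hn4
      have : (2 * ⌈(n : ℝ) ^ e⌉₊ : ℝ) ≤ n := by nlinarith
      exact_mod_cast this
  -- the limit `(n+1) exp(-k²/(32n)) → 0`: `k² ≥ n^{2e} = n · n^η`, `η = 2e - 1 > 0`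
  have hlim : Tendsto (fun n : ℕ => ((n : ℝ) + 1) *
      Real.exp (-((⌈(n : ℝ) ^ e⌉₊ : ℝ) ^ 2 / (32 * n)))) atTop (nhds 0) := by
    set η : ℝ := 2 * e - 1 with hηdef
    have hη : 0 < η := by linarith
    have hG := tendsto_rpow_mul_exp_neg_mul_atTop_nhds_zero (1 / η) (1 / 32) (by norm_num)
    have hy : Tendsto (fun n : ℕ => (n : ℝ) ^ η) atTop atTop :=
      (tendsto_rpow_atTop hη).comp tendsto_natCast_atTop_atTop
    have hlim2 : Tendsto (fun n : ℕ =>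
        2 * ((((n : ℝ) ^ η) ^ (1 / η)) * Real.exp (-(1 / 32) * (n : ℝ) ^ η))) atTop (nhds 0) := by
      simpa using (hG.comp hy).const_mul 2
    refine tendsto_of_tendsto_of_tendsto_of_le_of_le' tendsto_const_nhds hlim2
      (Eventually.of_forall fun n => by positivity) ?_
    filter_upwards [eventually_ge_atTop 1] with n hn1
    have hnpos : (0 : ℝ) < n := by exact_mod_cast hn1
    have hpow : ((n : ℝ) ^ η) ^ (1 / η) = n := by
      rw [← Real.rpow_mul hnpos.le, mul_one_div_cancel hη.ne', Real.rpow_one]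
    rw [hpow]
    have hk : (n : ℝ) ^ e ≤ ⌈(n : ℝ) ^ e⌉₊ := Nat.le_ceil _
    have hsq : (n : ℝ) ^ η * n = ((n : ℝ) ^ e) ^ 2 := by
      rw [← Real.rpow_natCast ((n : ℝ) ^ e) 2, ← Real.rpow_mul hnpos.le, ← Real.rpow_add_one hnpos.ne']
      congr 1
      rw [hηdef]; push_cast; ring
    have hk2 : (n : ℝ) ^ η * n ≤ (⌈(n : ℝ) ^ e⌉₊ : ℝ) ^ 2 := by
      rw [hsq]
      exact pow_le_pow_left₀ (by positivity) hk 2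
    have hexp : Real.exp (-((⌈(n : ℝ) ^ e⌉₊ : ℝ) ^ 2 / (32 * n))) ≤
        Real.exp (-(1 / 32) * (n : ℝ) ^ η) := by
      refine Real.exp_le_exp.2 ?_
      have : (1 / 32) * (n : ℝ) ^ η ≤ (⌈(n : ℝ) ^ e⌉₊ : ℝ) ^ 2 / (32 * n) := by
        rw [le_div_iff₀ (by positivity)]
        nlinarith
      linarith
    have hn1' : (n : ℝ) + 1 ≤ 2 * n := by
      have : (1 : ℝ) ≤ n := by exact_mod_cast hn1
      linarith
    calc ((n : ℝ) + 1) * Real.exp (-((⌈(n : ℝ) ^ e⌉₊ : ℝ) ^ 2 / (32 * n)))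
        ≤ (2 * n) * Real.exp (-(1 / 32) * (n : ℝ) ^ η) :=
          mul_le_mul hn1' hexp (by positivity) (by positivity)
      _ = 2 * (n * Real.exp (-(1 / 32) * (n : ℝ) ^ η)) := by ring
  obtain ⟨C, hB, hs, hT⟩ := degTest_detects hk hlim
  exact ⟨C, hs.mono fun n hn => ⟨hB n, hn⟩, hT⟩

/-- **The crux's `δ`-instance is FALSE for every `δ < 0`** — the hypothesis `0 < δ` of `MonotoneBlind` is
sharp up to the boundary point `δ = 0`: below `δ = 0` (cliques of size `n^{1/2+|δ|}`) the max-degree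
family is a monotone strong detector of size `≤ n⁴` (for `δ < -1/4` by monotonicity in the clique
size, `karlinRubin_detects_of_le`). At `δ = 0` exactly (`k = ⌈√n⌉`) strong detection by
polynomial-size MONOTONE circuits is open. [Kucera1995 §1] -/
theorem monotoneBlindAt_false_of_neg {δ : ℝ} (hδ : δ < 0) :
    ¬ ∀ c : ℕ, ¬ ∃ C : (n : ℕ) → Circuit ((⊤ : SimpleGraph (Fin n)).edgeSet),
      (∀ᶠ n : ℕ in atTop, (C n).IsOver monotoneBasis01 ∧ (C n).size ≤ n ^ c) ∧
        Tendsto (fun n : ℕ => (erdosRenyiHalf n).toOuterMeasure {x | (C n).eval x = true} +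
          (plantedCliqueDist n ⌈(n : ℝ) ^ (1 / 2 - δ)⌉₊).toOuterMeasure {x | (C n).eval x = false})
          atTop (nhds 0) := by
  intro h
  by_cases h4 : -1 / 4 ≤ δ
  · obtain ⟨C, hC, hT⟩ := exists_monotone_poly_strongDetector_of_neg h4 hδ
    exact h 4 ⟨C, hC, hT⟩
  · obtain ⟨C, hC, hT⟩ := exists_monotone_poly_strongDetector_of_neg (δ := -1 / 8)
      (by norm_num) (by norm_num)
    exact h 4 ⟨C, hC, Summit.PneNP.PneNP.Theorems.karlinRubin_detects_of_le
      (by linarith : δ ≤ -1 / 8) (hC.mono fun n hn => hn.1) hT⟩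

/-- Packaged: the crux with its range `(0, 1/2)` replaced by `(δ₀, 1/2)` is false for EVERY `δ₀ < 0`. -/
theorem monotoneBlind_false_on_any_larger_range {δ₀ : ℝ} (hδ₀ : δ₀ < 0) :
    ¬ ∀ δ : ℝ, δ₀ < δ → δ < 1 / 2 → ∀ c : ℕ,
      ¬ ∃ C : (n : ℕ) → Circuit ((⊤ : SimpleGraph (Fin n)).edgeSet),
        (∀ᶠ n : ℕ in atTop, (C n).IsOver monotoneBasis01 ∧ (C n).size ≤ n ^ c) ∧
          Tendsto (fun n : ℕ => (erdosRenyiHalf n).toOuterMeasure {x | (C n).eval x = true} +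
            (plantedCliqueDist n ⌈(n : ℝ) ^ (1 / 2 - δ)⌉₊).toOuterMeasure {x | (C n).eval x = false})
            atTop (nhds 0) := fun h =>
  monotoneBlindAt_false_of_neg (δ := δ₀ / 2) (by linarith) (h (δ₀ / 2) (by linarith) (by linarith))

end Summit.PneNP.PneNP.Theorems.MonotoneBlind.Negative
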